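import Literature.Probability.LatticeModels.TorusBlockKernels
import Literature.Probability.LatticeModels.TorusFourier
import Mathlib.Analysis.SpecialFunctions.Trigonometric.Bounds
import HarnessLib

/-!
# Momentum-space lattice sums on the finite torus: the dispersion dominates the torus distance,
# folding fine momenta onto a coarse torus, and the shell bound `Σ_{0<|s|_∞≤R} 1/|s|₂ ≤ 8R`

Elementary, model-free estimates used to turn a Gaussian-domination INFRARED BOUND
`f̂(p)² · E(p) ≤ C` (`E(p) = Σᵢ (1 - cos pᵢ)` the free lattice dispersion, `dispersion (latticeMomentum M p)`)
into bounds on momentum sums of `f̂` over an infrared box, uniformly in the side `M` of the torus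
`(ℤ/Mℤ)^d` — the discrete counterpart of the local integrability of `1/|p|` in `d = 2`
(Kennedy–Lieb–Shastry 1988, the `T = 0` infrared integral; Friedli–Velenik 2017 §10.4–10.5):

* `one_sub_cos_ge_min_sq` — Jordan's inequality on a full period,
  `1 - cos x ≥ (2/π²) min(x, 2π - x)²` on `[0, 2π]`;
* `dispersion_latticeMomentum_ge` — `E(p) ≥ (8/M²) Σᵢ ‖pᵢ‖²` with `‖pᵢ‖ = |valMinAbs pᵢ|` the distance
  to `0` in `ℤ/Mℤ`; `one_le_sum_valMinAbs_sq` — `Σᵢ ‖pᵢ‖² ≥ 1` for `p ≠ 0`;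
* `natAbs_valMinAbs_le_floor_of_cos_lt` — the cosine threshold `cos(2π a/m) > cos(2πρ)` puts `a` in
  the box `‖a‖ ≤ ⌊ρ m⌋`;
* `TorusBlock.natAbs_valMinAbs_reduce_le`, `TorusBlock.card_fold_le`, `TorusBlock.ne_zero_of_fold` —
  for `M = b·m`, the fold `p ↦ p mod m` of `TorusBlockFourier` does not decrease torus distances, has
  fibres of size `≤ b^d`, and nonzero coarse momenta have nonzero lifts;
* `latticeSum_inv_norm_le` — `Σ_{s ∈ [-R,R]² \ 0} 1/√(s₁²+s₂²) ≤ 8R` (the `ℓ^∞`-shell of radius `n`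
  has `8n` points at Euclidean distance `≥ n`); `sum_inv_sqrt_le_of_box` — the same sum over any set
  of nonzero momenta of `(ℤ/mℤ)²` inside the box, through the injection by signed representatives.

Sources: T. Kennedy, E. H. Lieb, B. S. Shastry, J. Stat. Phys. 53 (1988) 1019, eqs. (17)–(19);
S. Friedli, Y. Velenik, *Statistical Mechanics of Lattice Systems* (2017) §10.4; Mathlib
`Real.mul_le_sin` (Jordan), `ZMod.valMinAbs`. No definition is introduced; sorry-free.
-/

noncomputable section

open Finset
open scoped BigOperators Real

namespace Literature.Probability.LatticeModels

/-! ### Trigonometry: Jordan's inequality on a full period -/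

/-- **Jordan on a full period**: `1 - cos x ≥ (2/π²)·min(x, 2π - x)²` for `x ∈ [0, 2π]`
(`1 - cos x = 2 sin²(x/2)` and `sin y ≥ (2/π) y` on `[0, π/2]`, `Real.mul_le_sin`, applied to
`y = min(x, 2π - x)/2`). [folklore] -/
theorem one_sub_cos_ge_min_sq {x : ℝ} (h0 : 0 ≤ x) (h2 : x ≤ 2 * Real.pi) :
    2 * (min x (2 * Real.pi - x)) ^ 2 / Real.pi ^ 2 ≤ 1 - Real.cos x := by
  have hπ := Real.pi_pos
  obtain ⟨y, hyx, hy0, hyπ, hcos⟩ : ∃ y : ℝ, min x (2 * Real.pi - x) = y ∧ 0 ≤ y ∧ y ≤ Real.pi ∧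
      Real.cos x = Real.cos y := by
    rcases le_total x Real.pi with h | h
    · exact ⟨x, min_eq_left (by linarith), h0, h, rfl⟩
    · refine ⟨2 * Real.pi - x, min_eq_right (by linarith), by linarith, by linarith, ?_⟩
      rw [show 2 * Real.pi - x = -(x - 2 * Real.pi) by ring, Real.cos_neg, Real.cos_sub_two_pi]
  rw [hyx, hcos]
  have h1 : 1 - Real.cos y = 2 * Real.sin (y / 2) ^ 2 := by
    have h := Real.cos_sq (y / 2)
    rw [show 2 * (y / 2) = y by ring] at h
    nlinarith [Real.sin_sq_add_cos_sq (y / 2)]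
  have hj : 2 / Real.pi * (y / 2) ≤ Real.sin (y / 2) := Real.mul_le_sin (by linarith) (by linarith)
  have hj0 : 0 ≤ 2 / Real.pi * (y / 2) := by positivity
  have hsq : (2 / Real.pi * (y / 2)) ^ 2 ≤ Real.sin (y / 2) ^ 2 := pow_le_pow_left₀ hj0 hj 2
  rw [h1]
  have : 2 * y ^ 2 / Real.pi ^ 2 = 2 * (2 / Real.pi * (y / 2)) ^ 2 := by field_simp
  rw [this]
  linarith

/-- **Lattice form**: `1 - cos(2π v/M) ≥ 8·min(v, M - v)²/M²` for `v ≤ M`, `0 < M`. [folklore] -/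
theorem one_sub_cos_lattice_ge {M : ℕ} (hM : 0 < M) {v : ℕ} (hv : v ≤ M) :
    8 * ((min v (M - v) : ℕ) : ℝ) ^ 2 / (M : ℝ) ^ 2 ≤
      1 - Real.cos (2 * Real.pi * (v : ℝ) / (M : ℝ)) := by
  have hπ := Real.pi_pos
  have hMr : (0 : ℝ) < (M : ℝ) := by exact_mod_cast hM
  have hvr : (v : ℝ) ≤ (M : ℝ) := by exact_mod_cast hv
  have h0 : 0 ≤ 2 * Real.pi * (v : ℝ) / (M : ℝ) := by positivity
  have h2 : 2 * Real.pi * (v : ℝ) / (M : ℝ) ≤ 2 * Real.pi := by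
    rw [div_le_iff₀ hMr]
    nlinarith
  have hmin : min (2 * Real.pi * (v : ℝ) / (M : ℝ)) (2 * Real.pi - 2 * Real.pi * (v : ℝ) / (M : ℝ)) =
      (2 * Real.pi / (M : ℝ)) * ((min v (M - v) : ℕ) : ℝ) := by
    rw [Nat.cast_min, Nat.cast_sub hv]
    have e1 : 2 * Real.pi * (v : ℝ) / (M : ℝ) = (2 * Real.pi / (M : ℝ)) * (v : ℝ) := by ring
    have e2 : 2 * Real.pi - 2 * Real.pi * (v : ℝ) / (M : ℝ) =
        (2 * Real.pi / (M : ℝ)) * ((M : ℝ) - (v : ℝ)) := by field_simp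
    rw [e2, e1, ← mul_min_of_nonneg _ _ (by positivity : (0:ℝ) ≤ 2 * Real.pi / (M : ℝ))]
  have h := one_sub_cos_ge_min_sq h0 h2
  rw [hmin] at h
  have e3 : 2 * (2 * Real.pi / (M : ℝ) * ((min v (M - v) : ℕ) : ℝ)) ^ 2 / Real.pi ^ 2 =
      8 * ((min v (M - v) : ℕ) : ℝ) ^ 2 / (M : ℝ) ^ 2 := by
    field_simp
    ring
  rw [e3] at h
  exact h

/-! ### The free dispersion dominates the squared torus distance -/

/-- `(natAbs (valMinAbs a) : ℝ)² = (valMinAbs a : ℝ)²`. [folklore] -/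
theorem natAbs_valMinAbs_sq_eq {n : ℕ} (a : ZMod n) :
    ((a.valMinAbs.natAbs : ℕ) : ℝ) ^ 2 = ((a.valMinAbs : ℤ) : ℝ) ^ 2 := by
  rw [Nat.cast_natAbs, Int.cast_abs, sq_abs]

/-- **The lattice dispersion dominates the torus distance**: for every momentum `p` of the torus
`(ℤ/Mℤ)^d`, `Σᵢ (1 - cos pᵢ) ≥ (8/M²) Σᵢ ‖pᵢ‖²`, `‖pᵢ‖ = |valMinAbs pᵢ| = min(pᵢ.val, M - pᵢ.val)`
the distance to `0` in `ℤ/Mℤ`. [folklore] -/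
theorem dispersion_latticeMomentum_ge {d M : ℕ} [NeZero M] (p : TorusSite d M) :
    8 * (∑ i, (((p i).valMinAbs : ℤ) : ℝ) ^ 2) / (M : ℝ) ^ 2 ≤ dispersion (latticeMomentum M p) := by
  unfold dispersion
  rw [Finset.mul_sum, Finset.sum_div]
  refine Finset.sum_le_sum fun i _ => ?_
  have hM : 0 < M := Nat.pos_of_ne_zero (NeZero.ne M)
  have hv : (p i).val ≤ M := (ZMod.val_lt (p i)).le
  have h := one_sub_cos_lattice_ge hM hv
  rw [← ZMod.valMinAbs_natAbs_eq_min, natAbs_valMinAbs_sq_eq] at h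
  exact h

/-- **A nonzero momentum has torus distance at least one**: `Σᵢ ‖pᵢ‖² ≥ 1` for `p ≠ 0`. [folklore] -/
theorem one_le_sum_valMinAbs_sq {d M : ℕ} [NeZero M] {p : TorusSite d M} (hp : p ≠ 0) :
    (1 : ℝ) ≤ ∑ i, (((p i).valMinAbs : ℤ) : ℝ) ^ 2 := by
  obtain ⟨i, hi⟩ : ∃ i, p i ≠ 0 := by
    by_contra h
    push Not at h
    exact hp (funext h)
  have hne : (p i).valMinAbs ≠ 0 := fun h => hi ((ZMod.valMinAbs_eq_zero _).1 h)
  have h1 : (1 : ℝ) ≤ (((p i).valMinAbs : ℤ) : ℝ) ^ 2 := by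
    have habs : (1 : ℤ) ≤ |(p i).valMinAbs| := Int.one_le_abs hne
    have : (1 : ℝ) ≤ |(((p i).valMinAbs : ℤ) : ℝ)| := by exact_mod_cast habs
    nlinarith [sq_abs (((p i).valMinAbs : ℤ) : ℝ)]
  exact h1.trans (Finset.single_le_sum (f := fun j => (((p j).valMinAbs : ℤ) : ℝ) ^ 2)
    (fun j _ => sq_nonneg _) (Finset.mem_univ i))

/-! ### The infrared box: a cosine threshold confines the signed representative -/

/-- **Cosine threshold ⇒ box**: if `cos(2π a.val/m) > cos(2πρ)` (`ρ ≥ 0`) then the torus distance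
of `a ∈ ℤ/mℤ` to `0` is at most `⌊ρ m⌋` (`cos` is even about `π` in `2π a.val/m ↦ 2π(m - a.val)/m`
and decreasing on `[0, π]`). [folklore] -/
theorem natAbs_valMinAbs_le_floor_of_cos_lt {m : ℕ} [NeZero m] {ρ : ℝ} (hρ : 0 ≤ ρ) {a : ZMod m}
    (h : Real.cos (2 * Real.pi * ρ) < Real.cos (2 * Real.pi * (a.val : ℝ) / m)) :
    a.valMinAbs.natAbs ≤ ⌊ρ * m⌋₊ := by
  have hπ := Real.pi_pos
  have hm : 0 < m := Nat.pos_of_ne_zero (NeZero.ne m)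
  have hmr : (0 : ℝ) < (m : ℝ) := by exact_mod_cast hm
  set w : ℕ := a.valMinAbs.natAbs with hw
  have hwmin : w = min a.val (m - a.val) := ZMod.valMinAbs_natAbs_eq_min a
  have hwhalf : 2 * w ≤ m := by
    have := ZMod.natAbs_valMinAbs_le a
    omega
  have hv : a.val < m := ZMod.val_lt a
  -- `cos (2π a.val / m) = cos (2π w / m)`
  have hcos : Real.cos (2 * Real.pi * (a.val : ℝ) / m) = Real.cos (2 * Real.pi * (w : ℝ) / m) := by
    rcases min_cases a.val (m - a.val) with ⟨h1, -⟩ | ⟨h1, -⟩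
    · rw [hwmin, h1]
    · rw [hwmin, h1, Nat.cast_sub hv.le]
      have : 2 * Real.pi * ((m : ℝ) - (a.val : ℝ)) / m = -(2 * Real.pi * (a.val : ℝ) / m - 2 * Real.pi) := by
        field_simp
        ring
      rw [this, Real.cos_neg, Real.cos_sub_two_pi]
  rw [hcos] at h
  by_contra hlt
  push Not at hlt
  have hρw : ρ * m < w := Nat.lt_of_floor_lt hlt
  have h1 : 2 * Real.pi * ρ ≤ 2 * Real.pi * (w : ℝ) / m := by
    rw [le_div_iff₀ hmr]
    nlinarith
  have h2 : 2 * Real.pi * (w : ℝ) / m ≤ Real.pi := by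
    rw [div_le_iff₀ hmr]
    have : (2 * w : ℕ) ≤ (m : ℝ) := by exact_mod_cast hwhalf
    push_cast at this
    nlinarith
  have h3 : Real.cos (2 * Real.pi * (w : ℝ) / m) ≤ Real.cos (2 * Real.pi * ρ) :=
    Real.cos_le_cos_of_nonneg_of_le_pi (by positivity) h2 h1
  linarith

/-! ### Folding fine momenta onto the coarse torus (`M = b·m`) -/

namespace TorusBlock

/-- **The fold does not decrease the torus distance**: for `M = b·m` and `a ∈ ℤ/Mℤ`,
`‖a mod m‖_{ℤ/m} ≤ ‖a‖_{ℤ/M}`. [folklore] -/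
theorem natAbs_valMinAbs_reduce_le {b m M : ℕ} [NeZero M] [NeZero m] (hM : M = b * m)
    (a : ZMod M) :
    (((a.val : ℕ) : ZMod m)).valMinAbs.natAbs ≤ a.valMinAbs.natAbs := by
  rw [ZMod.valMinAbs_natAbs_eq_min, ZMod.valMinAbs_natAbs_eq_min, ZMod.val_natCast]
  have hv : a.val < b * m := lt_of_lt_of_le (ZMod.val_lt a) hM.le
  have hm : 0 < m := Nat.pos_of_ne_zero (NeZero.ne m)
  set v := a.val with hvdef
  have hmod_lt : v % m < m := Nat.mod_lt _ hm
  have hle1 : v % m ≤ v := Nat.mod_le _ _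
  -- `m - v % m ≤ M - v`: write `v = m * q + r`
  have hle2 : m - v % m ≤ M - v := by
    have hdecomp : m * (v / m) + v % m = v := Nat.div_add_mod v m
    have hq : v / m < b := by
      rw [Nat.div_lt_iff_lt_mul hm]; linarith [mul_comm b m]
    have : v + (m - v % m) ≤ M := by
      have hq1 : v / m + 1 ≤ b := hq
      calc v + (m - v % m) = m * (v / m) + m := by omega
        _ = m * (v / m + 1) := by ring
        _ ≤ m * b := Nat.mul_le_mul_left _ hq1
        _ = M := by rw [hM, mul_comm]
    have hvM : v ≤ M := by rw [hM]; linarith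
    omega
  exact min_le_min hle1 hle2

/-- **The fold set has at most `b^d` elements**: the fine momenta `p` with `p mod m = Q` are among
the `b^d` lifts `Q + m·r`, `r ∈ {0,…,b-1}^d`. [folklore] -/
theorem card_fold_le {d b m M : ℕ} [NeZero M] [NeZero m] (hM : M = b * m) (Q : TorusSite d m) :
    (univ.filter (fun p : TorusSite d M => (fun i => (((p i).val : ℕ) : ZMod m)) = Q)).card ≤ b ^ d := by
  classical
  have hb : 0 < b := TorusBlock.pos_of_eq_mul hM
  have hm : 0 < m := Nat.pos_of_ne_zero (NeZero.ne m)
  set lift : (Fin d → Fin b) → TorusSite d M := fun r i => (((Q i).val + m * (r i : ℕ) : ℕ) : ZMod M)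
    with hlift
  have hsub : univ.filter (fun p : TorusSite d M => (fun i => (((p i).val : ℕ) : ZMod m)) = Q) ⊆
      (univ : Finset (Fin d → Fin b)).image lift := by
    intro p hp
    rw [Finset.mem_filter] at hp
    obtain ⟨-, hpQ⟩ := hp
    rw [Finset.mem_image]
    have hdiv : ∀ i, (p i).val / m < b := fun i => by
      rw [Nat.div_lt_iff_lt_mul hm]
      have := lt_of_lt_of_le (ZMod.val_lt (p i)) hM.le
      linarith [mul_comm b m]
    refine ⟨fun i => ⟨(p i).val / m, hdiv i⟩, Finset.mem_univ _, ?_⟩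
    funext i
    have hQi : (Q i).val = (p i).val % m := by
      have h' : (((p i).val : ℕ) : ZMod m) = Q i := congrFun hpQ i
      rw [← h', ZMod.val_natCast]
    simp only [hlift, hQi]
    rw [Nat.mod_add_div, ZMod.natCast_zmod_val]
  calc (univ.filter (fun p : TorusSite d M => (fun i => (((p i).val : ℕ) : ZMod m)) = Q)).card
      ≤ ((univ : Finset (Fin d → Fin b)).image lift).card := Finset.card_le_card hsub
    _ ≤ (univ : Finset (Fin d → Fin b)).card := Finset.card_image_le
    _ = b ^ d := by simp

/-- **Every fine momentum above a nonzero coarse momentum is nonzero.** [folklore] -/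
theorem ne_zero_of_fold {d m M : ℕ} [NeZero M] [NeZero m] {Q : TorusSite d m} (hQ : Q ≠ 0)
    {p : TorusSite d M} (hp : (fun i => (((p i).val : ℕ) : ZMod m)) = Q) : p ≠ 0 := by
  rintro rfl
  apply hQ
  rw [← hp]
  funext i
  simp

end TorusBlock

/-! ### The lattice sum `Σ_{0 < |s|_∞ ≤ R} 1/|s|₂ ≤ 8R` on `ℤ²`, and its torus form -/

/-- **Shell summation**: `Σ_{s ∈ [-R,R]², s ≠ 0} 1/√(s₁² + s₂²) ≤ 8R` (the `ℓ^∞`-shell of radius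
`n` has `8n` points, each at Euclidean distance `≥ n`). [folklore] -/
theorem latticeSum_inv_norm_le (R : ℕ) :
    ∑ s ∈ ((Finset.Icc (-(R : ℤ)) R) ×ˢ (Finset.Icc (-(R : ℤ)) R)).filter (fun s => s ≠ 0),
      1 / Real.sqrt (((s.1 : ℤ) : ℝ) ^ 2 + ((s.2 : ℤ) : ℝ) ^ 2) ≤ 8 * R := by
  classical
  set B : ℕ → Finset (ℤ × ℤ) := fun n => (Finset.Icc (-(n : ℤ)) n) ×ˢ (Finset.Icc (-(n : ℤ)) n)
    with hB
  set f : ℤ × ℤ → ℝ := fun s => 1 / Real.sqrt (((s.1 : ℤ) : ℝ) ^ 2 + ((s.2 : ℤ) : ℝ) ^ 2) with hf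
  have hf0 : ∀ s, 0 ≤ f s := fun s => by positivity
  have hIcc : ∀ n : ℕ, (Finset.Icc (-(n : ℤ)) n).card = 2 * n + 1 := fun n => by
    rw [Int.card_Icc]; omega
  have hcardB : ∀ n : ℕ, (B n).card = (2 * n + 1) ^ 2 := fun n => by
    rw [hB, Finset.card_product, hIcc]; ring
  have hmono : ∀ n : ℕ, B n ⊆ B (n + 1) := fun n => by
    intro s hs
    simp only [hB, Finset.mem_product, Finset.mem_Icc] at hs ⊢
    push_cast
    omega
  have hzero : ∀ n : ℕ, (0 : ℤ × ℤ) ∈ B n := fun n => by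
    simp [hB]
  -- on the shell `B (n+1) \ B n` every point has `f ≤ 1/(n+1)`
  have hshell : ∀ n : ℕ, ∀ s ∈ B (n + 1) \ B n, f s ≤ 1 / ((n : ℝ) + 1) := by
    intro n s hs
    rw [Finset.mem_sdiff] at hs
    obtain ⟨hs1, hs2⟩ := hs
    simp only [hB, Finset.mem_product, Finset.mem_Icc, not_and_or, not_le] at hs1 hs2
    have hbig : ((n : ℝ) + 1) ^ 2 ≤ ((s.1 : ℤ) : ℝ) ^ 2 + ((s.2 : ℤ) : ℝ) ^ 2 := by
      have h1 : ((n : ℤ) + 1) ^ 2 ≤ s.1 ^ 2 ∨ ((n : ℤ) + 1) ^ 2 ≤ s.2 ^ 2 := by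
        push_cast at hs1
        rcases hs2 with (h | h) | (h | h) <;> [left; left; right; right] <;> nlinarith
      rcases h1 with h | h
      · have : (((n : ℤ) + 1) ^ 2 : ℝ) ≤ ((s.1 ^ 2 : ℤ) : ℝ) := by exact_mod_cast h
        push_cast at this
        nlinarith [sq_nonneg ((s.2 : ℤ) : ℝ)]
      · have : (((n : ℤ) + 1) ^ 2 : ℝ) ≤ ((s.2 ^ 2 : ℤ) : ℝ) := by exact_mod_cast h
        push_cast at this
        nlinarith [sq_nonneg ((s.1 : ℤ) : ℝ)]
    have hpos : (0 : ℝ) < (n : ℝ) + 1 := by positivity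
    rw [hf]
    simp only
    rw [div_le_div_iff₀ (Real.sqrt_pos.2 (lt_of_lt_of_le (by positivity) hbig)) hpos, one_mul, one_mul]
    calc (n : ℝ) + 1 = Real.sqrt (((n : ℝ) + 1) ^ 2) := (Real.sqrt_sq hpos.le).symm
      _ ≤ _ := Real.sqrt_le_sqrt hbig
  -- induction on `R`
  suffices H : ∀ n : ℕ, ∑ s ∈ (B n).filter (fun s => s ≠ 0), f s ≤ 8 * n by
    simpa [hB, hf] using H R
  intro n
  induction n with
  | zero =>
    have : (B 0).filter (fun s => s ≠ 0) = ∅ := by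
      ext s
      simp only [hB, Finset.mem_filter, Finset.mem_product, Finset.mem_Icc, Finset.notMem_empty,
        iff_false, not_and, not_not]
      intro h
      push_cast at h
      ext <;> simp <;> omega
    rw [this, Finset.sum_empty]
    simp
  | succ n ih =>
    have hsplit : (B (n + 1)).filter (fun s => s ≠ 0) =
        (B n).filter (fun s => s ≠ 0) ∪ (B (n + 1) \ B n) := by
      ext s
      simp only [Finset.mem_filter, Finset.mem_union, Finset.mem_sdiff]
      constructor
      · rintro ⟨h1, h2⟩
        by_cases h : s ∈ B n
        · exact Or.inl ⟨h, h2⟩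
        · exact Or.inr ⟨h1, h⟩
      · rintro (⟨h1, h2⟩ | ⟨h1, h2⟩)
        · exact ⟨hmono n h1, h2⟩
        · exact ⟨h1, fun h => h2 (h ▸ hzero n)⟩
    have hdisj : Disjoint ((B n).filter (fun s => s ≠ 0)) (B (n + 1) \ B n) := by
      rw [Finset.disjoint_left]
      intro s hs hs'
      exact (Finset.mem_sdiff.1 hs').2 (Finset.mem_filter.1 hs).1
    rw [hsplit, Finset.sum_union hdisj]
    have hcard : ((B (n + 1) \ B n).card : ℝ) = 8 * ((n : ℝ) + 1) := by
      rw [Finset.card_sdiff_of_subset (hmono n), hcardB, hcardB]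
      have : (2 * n + 1) ^ 2 ≤ (2 * (n + 1) + 1) ^ 2 := Nat.pow_le_pow_left (by omega) 2
      push_cast [Nat.cast_sub this]
      ring
    have h2 : ∑ s ∈ B (n + 1) \ B n, f s ≤ 8 := by
      calc ∑ s ∈ B (n + 1) \ B n, f s ≤ ∑ _s ∈ B (n + 1) \ B n, 1 / ((n : ℝ) + 1) :=
            Finset.sum_le_sum (hshell n)
        _ = ((B (n + 1) \ B n).card : ℝ) * (1 / ((n : ℝ) + 1)) := by
            rw [Finset.sum_const, nsmul_eq_mul]
        _ = 8 := by rw [hcard]; field_simp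
    push_cast
    linarith

/-- **Momenta of the infrared box inject into `[-R, R]² \ {0} ⊂ ℤ²`** through their signed
representatives, with the summand `1/√(Σᵢ ‖Qᵢ‖²)` carried along: for any finite set `S` of nonzero
coarse momenta all of whose coordinates have torus distance `≤ R`,
`Σ_{Q ∈ S} 1/√(‖Q₀‖² + ‖Q₁‖²) ≤ 8R` (`latticeSum_inv_norm_le`). [folklore] -/
theorem sum_inv_sqrt_le_of_box {m : ℕ} [NeZero m] (R : ℕ) (S : Finset (TorusSite 2 m))
    (h0 : ∀ Q ∈ S, Q ≠ 0) (hbox : ∀ Q ∈ S, ∀ i : Fin 2, (Q i).valMinAbs.natAbs ≤ R) :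
    ∑ Q ∈ S, 1 / Real.sqrt (∑ i : Fin 2, (((Q i).valMinAbs : ℤ) : ℝ) ^ 2) ≤ 8 * R := by
  classical
  set φ : TorusSite 2 m → ℤ × ℤ := fun Q => ((Q 0).valMinAbs, (Q 1).valMinAbs) with hφ
  set f : ℤ × ℤ → ℝ := fun s => 1 / Real.sqrt (((s.1 : ℤ) : ℝ) ^ 2 + ((s.2 : ℤ) : ℝ) ^ 2) with hf
  have hinj : Set.InjOn φ S := by
    intro P _ Q _ hPQ
    simp only [hφ, Prod.mk.injEq] at hPQ
    funext i
    fin_cases i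
    · exact ZMod.injective_valMinAbs hPQ.1
    · exact ZMod.injective_valMinAbs hPQ.2
  have hsum : ∑ Q ∈ S, 1 / Real.sqrt (∑ i : Fin 2, (((Q i).valMinAbs : ℤ) : ℝ) ^ 2) =
      ∑ s ∈ S.image φ, f s := by
    rw [Finset.sum_image hinj]
    refine Finset.sum_congr rfl fun Q _ => ?_
    simp only [hf, hφ, Fin.sum_univ_two]
  rw [hsum]
  have hsub : S.image φ ⊆
      ((Finset.Icc (-(R : ℤ)) R) ×ˢ (Finset.Icc (-(R : ℤ)) R)).filter (fun s => s ≠ 0) := by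
    intro s hs
    rw [Finset.mem_image] at hs
    obtain ⟨Q, hQ, rfl⟩ := hs
    have hc : ∀ i : Fin 2, -(R : ℤ) ≤ (Q i).valMinAbs ∧ (Q i).valMinAbs ≤ R := fun i => by
      have h := hbox Q hQ i
      have : |(Q i).valMinAbs| ≤ (R : ℤ) := by
        rw [← Int.natCast_natAbs]; exact_mod_cast h
      exact abs_le.1 this
    simp only [Finset.mem_filter, Finset.mem_product, Finset.mem_Icc, hφ]
    refine ⟨⟨hc 0, hc 1⟩, ?_⟩
    intro hzero
    simp only [Prod.mk_eq_zero, ZMod.valMinAbs_eq_zero] at hzero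
    apply h0 Q hQ
    funext i
    fin_cases i
    · exact hzero.1
    · exact hzero.2
  calc ∑ s ∈ S.image φ, f s
      ≤ ∑ s ∈ ((Finset.Icc (-(R : ℤ)) R) ×ˢ (Finset.Icc (-(R : ℤ)) R)).filter (fun s => s ≠ 0), f s :=
        Finset.sum_le_sum_of_subset_of_nonneg hsub fun s _ _ => by positivity
    _ ≤ 8 * R := latticeSum_inv_norm_le R

end Literature.Probability.LatticeModels

end
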